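import Mathlib.Analysis.Calculus.SmoothSeries
import Mathlib.Analysis.SpecialFunctions.Complex.Arctan
import Mathlib.Analysis.SpecialFunctions.Log.Deriv
import Literature.NumberTheory.LFunctions.ZetaScrew
import HarnessLib

/-!
# Route `IntegerScrew` — the derivative of Suzuki's screw function `Ψ` on `(0, log 2)` in closed form

For `0 < t < log 2` the prime sum of `Ψ = zetaScrew` (Suzuki2023 (1.1)) is empty
(`zetaScrew_eq_of_abs_lt_log_two`), and the Hurwitz–Lerch piece
`e^{-t/2} Φ(e^{-2t}, 2, 1/4) = ∑_{k ≥ 0} e^{-2t(k + 1/4)} (k + 1/4)^{-2}` is differentiable term by term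
with derivative `-2 ∑_{k ≥ 0} e^{-2t(k + 1/4)} (k + 1/4)^{-1} = -8 ∑_k w^{4k+1}/(4k+1)`, `w = e^{-t/2}`,
and the last series is ELEMENTARY: `∑_k w^{4k+1}/(4k+1) = (artanh w + arctan w)/2` (the even part of
the Taylor series of `artanh` and `arctan`). Hence

`Ψ'(t) = 2(e^{t/2} - e^{-t/2}) - (γ₀ + π/2 + 3 log 2 + log π)/2 + artanh(e^{-t/2}) + arctan(e^{-t/2})`,
`artanh w = (log(1 + w) - log(1 - w))/2`, for `0 < t < log 2` (`hasDerivAt_zetaScrew`), and the derivative of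
this closed form, `Ψ''(t) = e^{t/2} + e^{-t/2} - w/(2(1-w²)) - w/(2(1+w²)) = 2cosh(t/2) - e^{-t/2}/(1 - e^{-2t})`
(`hasDerivAt_zetaScrewDeriv`, `t > 0`), and once more `Ψ⁽³⁾` (`hasDerivAt_zetaScrewDeriv2`).

This makes the small-argument behaviour of `Ψ` (the `-(t/2) log t` cusp and its Taylor tail)
accessible by elementary means (no Bernoulli-polynomial / digamma theory): it is the analytic input
of the kernel certificate for the top-block pairing negativity of the manifest-wave obstruction
(`IntegerScrewTopBlockNeg…`, SCREW column, rh-explicit cell); a computation of ours from the tree's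
definition `Literature.NumberTheory.LFunctions.zetaScrew` (hence under `Theorems/`, not `Literature/`).
Nothing here bears on the truth of RH. References: M. Suzuki, J. Lond. Math. Soc. (2) 108 (2023), (1.1) and proof of
Thm 4.1 [Suzuki2023]; the series manipulations are [folklore].
-/

set_option linter.dupNamespace false
set_option autoImplicit false

noncomputable section

open scoped Topology BigOperators
open Real Filter Set

namespace Summit.RiemannHypothesis.RiemannHypothesis.Theorems.IntegerScrew

open Literature.NumberTheory.LFunctions

/-! ## The shifted Hurwitz–Lerch series `∑ e^{-2t(k+1/4)}/(k+1/4)²` and its derivative series -/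

/-- `∑_{k ≥ 0} e^{-2t(k + 1/4)} (k + 1/4)^{-2}` (`= e^{-t/2} Φ(e^{-2t}, 2, 1/4)` for `t ≥ 0`,
`hurwitzLerchQuarterShift_eq`). [cite: Suzuki2023, (1.1)] -/
def hurwitzLerchQuarterShift (t : ℝ) : ℝ :=
  ∑' k : ℕ, Real.exp (-(2 * t * ((k : ℝ) + 1 / 4))) / ((k : ℝ) + 1 / 4) ^ 2

/-- The term-by-term derivative series `∑_{k ≥ 0} e^{-2t(k + 1/4)} (k + 1/4)^{-1}` (up to the factor
`-2`). [folklore] -/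
def hurwitzLerchQuarterDerivSeries (t : ℝ) : ℝ :=
  ∑' k : ℕ, Real.exp (-(2 * t * ((k : ℝ) + 1 / 4))) / ((k : ℝ) + 1 / 4)

/-- `0 < k + 1/4`. [folklore] -/
private lemma quarter_pos (k : ℕ) : (0 : ℝ) < (k : ℝ) + 1 / 4 := by positivity

/-- `e^{-2t(k+1/4)} = e^{-t/2} · e^{-2tk}`. [folklore] -/
theorem exp_shift_split (t : ℝ) (k : ℕ) :
    Real.exp (-(2 * t * ((k : ℝ) + 1 / 4))) = Real.exp (-(t / 2)) * Real.exp (-(2 * t * k)) := by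
  rw [← Real.exp_add]; congr 1; ring

/-- For `t ≥ 0`: `∑ e^{-2t(k+1/4)}/(k+1/4)² = e^{-t/2} · hurwitzLerchQuarter t`. [cite: Suzuki2023, (1.1)] -/
theorem hurwitzLerchQuarterShift_eq {t : ℝ} (ht : 0 ≤ t) :
    hurwitzLerchQuarterShift t = Real.exp (-(t / 2)) * hurwitzLerchQuarter t := by
  unfold hurwitzLerchQuarterShift hurwitzLerchQuarter
  rw [← tsum_mul_left]
  congr 1; funext k
  rw [abs_of_nonneg ht, exp_shift_split]; ring

/-- The terms of the shifted series are dominated by the `p`-series `(k + 1/4)^{-2}` (`t ≥ 0`). [folklore] -/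
theorem summable_hurwitzLerchQuarterShift_terms {t : ℝ} (ht : 0 ≤ t) :
    Summable fun k : ℕ => Real.exp (-(2 * t * ((k : ℝ) + 1 / 4))) / ((k : ℝ) + 1 / 4) ^ 2 := by
  refine Summable.of_nonneg_of_le (fun k => by positivity) (fun k => ?_) summable_one_div_nat_add_quarter_sq
  have hk := quarter_pos k
  have : Real.exp (-(2 * t * ((k : ℝ) + 1 / 4))) ≤ 1 := by
    rw [Real.exp_le_one_iff]; nlinarith
  exact div_le_div_of_nonneg_right this (by positivity)

/-- **Term-by-term differentiation** (`t > 0`):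
`d/dt ∑ e^{-2t(k+1/4)}/(k+1/4)² = -2 ∑ e^{-2t(k+1/4)}/(k+1/4)`. [folklore] -/
theorem hasDerivAt_hurwitzLerchQuarterShift {t : ℝ} (ht : 0 < t) :
    HasDerivAt hurwitzLerchQuarterShift (-2 * hurwitzLerchQuarterDerivSeries t) t := by
  -- the family, its derivatives, and a summable bound on the open half-line `(t/2, ∞)`
  set g : ℕ → ℝ → ℝ := fun k y => Real.exp (-(2 * y * ((k : ℝ) + 1 / 4))) / ((k : ℝ) + 1 / 4) ^ 2 with hg
  set g' : ℕ → ℝ → ℝ := fun k y => -2 * (Real.exp (-(2 * y * ((k : ℝ) + 1 / 4))) / ((k : ℝ) + 1 / 4))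
    with hg'
  set u : ℕ → ℝ := fun k => 8 * Real.exp (-(t / 4)) * Real.exp (-t) ^ k with hu
  have hu_sum : Summable u := by
    have h1 : Real.exp (-t) < 1 := by rw [Real.exp_lt_one_iff]; linarith
    exact (summable_geometric_of_lt_one (Real.exp_pos _).le h1).mul_left _
  have hderiv : ∀ k y, y ∈ Set.Ioi (t / 2) → HasDerivAt (g k) (g' k y) y := by
    intro k y _
    have hc := quarter_pos k
    have h1 : HasDerivAt (fun y : ℝ => -(2 * y * ((k : ℝ) + 1 / 4))) (-(2 * ((k : ℝ) + 1 / 4))) y := by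
      have h := ((hasDerivAt_id y).const_mul (2 * ((k : ℝ) + 1 / 4))).neg
      have e : (-fun x : ℝ => 2 * ((k : ℝ) + 1 / 4) * id x) = fun y : ℝ => -(2 * y * ((k : ℝ) + 1 / 4)) := by
        funext x; simp only [Pi.neg_apply, id]; ring
      rw [e] at h
      exact h.congr_deriv (by simp)
    have h2 := h1.exp.div_const (((k : ℝ) + 1 / 4) ^ 2)
    have e2 : (fun x : ℝ => Real.exp (-(2 * x * ((k : ℝ) + 1 / 4))) / ((k : ℝ) + 1 / 4) ^ 2) = g k := by
      funext x; simp only [hg]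
    rw [e2] at h2
    refine h2.congr_deriv ?_
    simp only [hg']
    field_simp
  have hbound : ∀ k y, y ∈ Set.Ioi (t / 2) → ‖g' k y‖ ≤ u k := by
    intro k y hy
    have hc := quarter_pos k
    rw [Set.mem_Ioi] at hy
    have hexp : Real.exp (-(2 * y * ((k : ℝ) + 1 / 4))) ≤ Real.exp (-(t / 4)) * Real.exp (-t) ^ k := by
      rw [← Real.exp_nat_mul, ← Real.exp_add, Real.exp_le_exp]
      nlinarith [mul_pos hc (by linarith : (0 : ℝ) < 2 * y - t)]
    have hinv : (1 : ℝ) / ((k : ℝ) + 1 / 4) ≤ 4 := by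
      rw [div_le_iff₀ hc]; linarith [(Nat.cast_nonneg k : (0 : ℝ) ≤ k)]
    simp only [hg', hu, Real.norm_eq_abs]
    rw [abs_of_nonpos (by
      have : 0 ≤ Real.exp (-(2 * y * ((k : ℝ) + 1 / 4))) / ((k : ℝ) + 1 / 4) := by positivity
      linarith)]
    have : Real.exp (-(2 * y * ((k : ℝ) + 1 / 4))) / ((k : ℝ) + 1 / 4)
        ≤ (Real.exp (-(t / 4)) * Real.exp (-t) ^ k) * 4 := by
      rw [div_eq_mul_one_div]
      exact mul_le_mul hexp hinv (by positivity) (by positivity)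
    linarith
  have hmem : t ∈ Set.Ioi (t / 2) := by rw [Set.mem_Ioi]; linarith
  have hsum0 : Summable fun k => g k t := summable_hurwitzLerchQuarterShift_terms ht.le
  have hmain := hasDerivAt_tsum_of_isPreconnected hu_sum isOpen_Ioi isPreconnected_Ioi hderiv hbound
    hmem hsum0 hmem
  -- identify the function and the value of the derivative series
  have hfun : (fun z => ∑' k, g k z) = hurwitzLerchQuarterShift := by
    funext z; rfl
  have hval : (∑' k, g' k t) = -2 * hurwitzLerchQuarterDerivSeries t := by
    simp only [hg', hurwitzLerchQuarterDerivSeries]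
    rw [tsum_mul_left]
  rw [hfun, hval] at hmain
  exact hmain

/-! ## The derivative series in closed form: `∑ w^{4k+1}/(4k+1) = (artanh w + arctan w)/2` -/

/-- The even part of the `artanh`/`arctan` series: for `|w| < 1`,
`∑_k w^{4k+1}/(4k+1) = ((log(1+w) - log(1-w))/2 + arctan w)/2`. [folklore] -/
theorem hasSum_pow_four_mul_add_one_div {w : ℝ} (hw : |w| < 1) :
    HasSum (fun k : ℕ => w ^ (4 * k + 1) / (4 * (k : ℝ) + 1))
      (((Real.log (1 + w) - Real.log (1 - w)) / 2 + Real.arctan w) / 2) := by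
  -- `a n = w^{2n+1}/(2n+1)`: `∑ a n = artanh w`, `∑ (-1)^n a n = arctan w`
  set a : ℕ → ℝ := fun n => w ^ (2 * n + 1) / (2 * (n : ℝ) + 1) with ha
  have h1 : HasSum a ((Real.log (1 + w) - Real.log (1 - w)) / 2) := by
    have h := (hasSum_log_sub_log_of_abs_lt_one hw).mul_left (1 / 2)
    have e1 : (fun i : ℕ => (1 : ℝ) / 2 * (2 * (1 / (2 * (i : ℝ) + 1)) * w ^ (2 * i + 1))) = a := by
      funext i; simp only [ha]; ring
    rw [e1, show (1 : ℝ) / 2 * (Real.log (1 + w) - Real.log (1 - w))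
      = (Real.log (1 + w) - Real.log (1 - w)) / 2 by ring] at h
    exact h
  have h2 : HasSum (fun n => (-1) ^ n * a n) (Real.arctan w) := by
    have h := Real.hasSum_arctan (x := w) (by simpa [Real.norm_eq_abs] using hw)
    have e2 : (fun n : ℕ => (-1 : ℝ) ^ n * w ^ (2 * n + 1) / ((2 * n + 1 : ℕ) : ℝ))
        = fun n => (-1) ^ n * a n := by
      funext n; simp only [ha]; push_cast; ring
    rw [e2] at h
    exact h
  have h12 : HasSum (fun n => a n + (-1) ^ n * a n)
      ((Real.log (1 + w) - Real.log (1 - w)) / 2 + Real.arctan w) := h1.add h2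
  -- the odd-indexed terms vanish, the even-indexed ones are `2 a (2k) = 2 w^{4k+1}/(4k+1)`
  set b : ℕ → ℝ := fun n => a n + (-1) ^ n * a n with hb
  have hbodd : ∀ x ∉ Set.range (fun k : ℕ => 2 * k), b x = 0 := by
    intro x hx
    rcases Nat.even_or_odd x with h | h
    · obtain ⟨r, hr⟩ := h
      exact (hx ⟨r, by show 2 * r = x; omega⟩).elim
    · simp only [hb, h.neg_one_pow]; ring
  have hinj : Function.Injective (fun k : ℕ => 2 * k) := fun x y h => by simpa using h
  have heven : HasSum (b ∘ fun k : ℕ => 2 * k)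
      ((Real.log (1 + w) - Real.log (1 - w)) / 2 + Real.arctan w) :=
    (hinj.hasSum_iff hbodd).2 h12
  have heq : (b ∘ fun k : ℕ => 2 * k) = fun k : ℕ => 2 * (w ^ (4 * k + 1) / (4 * (k : ℝ) + 1)) := by
    funext k
    simp only [Function.comp_apply, hb, ha, (even_two_mul k).neg_one_pow, one_mul]
    rw [show 2 * (2 * k) + 1 = 4 * k + 1 by ring]
    push_cast
    ring
  rw [heq] at heven
  have h := heven.mul_left (1 / 2)
  have e3 : (fun i : ℕ => (1 : ℝ) / 2 * (2 * (w ^ (4 * i + 1) / (4 * (i : ℝ) + 1))))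
      = fun k : ℕ => w ^ (4 * k + 1) / (4 * (k : ℝ) + 1) := by
    funext i; ring
  rw [e3, show (1 : ℝ) / 2 * ((Real.log (1 + w) - Real.log (1 - w)) / 2 + Real.arctan w)
    = ((Real.log (1 + w) - Real.log (1 - w)) / 2 + Real.arctan w) / 2 by ring] at h
  exact h

/-- **Closed form of the derivative series** (`t > 0`, `w = e^{-t/2}`):
`∑ e^{-2t(k+1/4)}/(k+1/4) = (log(1+w) - log(1-w)) + 2 arctan w`. [folklore] -/
theorem hurwitzLerchQuarterDerivSeries_eq {t : ℝ} (ht : 0 < t) :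
    hurwitzLerchQuarterDerivSeries t
      = (Real.log (1 + Real.exp (-(t / 2))) - Real.log (1 - Real.exp (-(t / 2))))
        + 2 * Real.arctan (Real.exp (-(t / 2))) := by
  set w := Real.exp (-(t / 2)) with hw
  have hw0 : 0 < w := Real.exp_pos _
  have hw1 : w < 1 := by rw [hw, Real.exp_lt_one_iff]; linarith
  have hwabs : |w| < 1 := by rw [abs_of_pos hw0]; exact hw1
  -- termwise: `e^{-2t(k+1/4)}/(k+1/4) = 4 · w^{4k+1}/(4k+1)`
  have hterm : ∀ k : ℕ, Real.exp (-(2 * t * ((k : ℝ) + 1 / 4))) / ((k : ℝ) + 1 / 4)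
      = 4 * (w ^ (4 * k + 1) / (4 * (k : ℝ) + 1)) := by
    intro k
    have hc := quarter_pos k
    have hpow : Real.exp (-(2 * t * ((k : ℝ) + 1 / 4))) = w ^ (4 * k + 1) := by
      rw [hw, ← Real.exp_nat_mul]; congr 1; push_cast; ring
    rw [hpow]
    field_simp
  unfold hurwitzLerchQuarterDerivSeries
  simp_rw [hterm]
  rw [tsum_mul_left, (hasSum_pow_four_mul_add_one_div hwabs).tsum_eq]
  ring

/-! ## The derivative of `Ψ` on `(0, log 2)` -/

/-- The closed form of `Ψ'` on `(0, log 2)`: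
`2(e^{t/2} - e^{-t/2}) - (γ₀ + π/2 + 3 log 2 + log π)/2 + artanh(e^{-t/2}) + arctan(e^{-t/2})`. [folklore] -/
def zetaScrewDeriv (t : ℝ) : ℝ :=
  2 * (Real.exp (t / 2) - Real.exp (-(t / 2)))
    - (Real.eulerMascheroniConstant + Real.pi / 2 + 3 * Real.log 2 + Real.log Real.pi) / 2
    + ((Real.log (1 + Real.exp (-(t / 2))) - Real.log (1 - Real.exp (-(t / 2)))) / 2
        + Real.arctan (Real.exp (-(t / 2))))

/-- On `(0, log 2)`, `Ψ` agrees with its prime-free closed form written with the shifted series. [cite: Suzuki2023, proof of Thm 4.1] -/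
theorem zetaScrew_eq_shift_of_pos_lt_log_two {t : ℝ} (h0 : 0 < t) (h2 : t < Real.log 2) :
    zetaScrew t = 4 * (Real.exp (t / 2) + Real.exp (-(t / 2)) - 2)
      - t / 2 * (Real.eulerMascheroniConstant + Real.pi / 2 + 3 * Real.log 2 + Real.log Real.pi)
      + (1 / 4) * ((∑' k : ℕ, 1 / ((k : ℝ) + 1 / 4) ^ 2) - hurwitzLerchQuarterShift t) := by
  have habs : |t| < Real.log 2 := by rw [abs_of_pos h0]; exact h2
  rw [zetaScrew_eq_of_abs_lt_log_two habs, hurwitzLerchQuarterShift_eq h0.le, abs_of_pos h0]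

/-- **The derivative of Suzuki's `Ψ` on `(0, log 2)`** in closed form. [folklore] -/
theorem hasDerivAt_zetaScrew {t : ℝ} (h0 : 0 < t) (h2 : t < Real.log 2) :
    HasDerivAt zetaScrew (zetaScrewDeriv t) t := by
  -- the closed form `F` and its derivative
  set κ := Real.eulerMascheroniConstant + Real.pi / 2 + 3 * Real.log 2 + Real.log Real.pi with hκ
  set C := ∑' k : ℕ, 1 / ((k : ℝ) + 1 / 4) ^ 2 with hC
  set F : ℝ → ℝ := fun y => 4 * (Real.exp (y / 2) + Real.exp (-(y / 2)) - 2) - y / 2 * κ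
      + (1 / 4) * (C - hurwitzLerchQuarterShift y) with hF
  have hFeq : zetaScrew =ᶠ[𝓝 t] F := by
    have hmem : Set.Ioo 0 (Real.log 2) ∈ 𝓝 t := Ioo_mem_nhds h0 h2
    filter_upwards [hmem] with y hy
    exact zetaScrew_eq_shift_of_pos_lt_log_two hy.1 hy.2
  have hA : HasDerivAt (fun y : ℝ => Real.exp (y / 2)) (Real.exp (t / 2) * (1 / 2)) t := by
    have h := ((hasDerivAt_id t).div_const 2).exp
    simp only [id] at h
    exact h
  have hB : HasDerivAt (fun y : ℝ => Real.exp (-(y / 2))) (Real.exp (-(t / 2)) * -(1 / 2)) t := by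
    have h := ((hasDerivAt_id t).div_const 2).neg.exp
    simp only [id] at h
    exact h
  have hL : HasDerivAt (fun y : ℝ => y / 2 * κ) (1 / 2 * κ) t := by
    have h := ((hasDerivAt_id t).div_const 2).mul_const κ
    simp only [id] at h
    exact h
  have hS := hasDerivAt_hurwitzLerchQuarterShift h0
  have h1 := ((hA.add hB).sub_const 2).const_mul 4
  have h3 := ((hasDerivAt_const t C).sub hS).const_mul (1 / 4)
  have h := (h1.sub hL).add h3
  -- `h` is the derivative of (a pointwise form of) `F`
  have hF' : HasDerivAt F (4 * (Real.exp (t / 2) * (1 / 2) + Real.exp (-(t / 2)) * -(1 / 2)) - 1 / 2 * κ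
      + (1 / 4) * (0 - -2 * hurwitzLerchQuarterDerivSeries t)) t := by
    refine h.congr_of_eventuallyEq (Filter.Eventually.of_forall fun y => ?_)
    simp only [hF, Pi.add_apply, Pi.sub_apply]
  have hval : 4 * (Real.exp (t / 2) * (1 / 2) + Real.exp (-(t / 2)) * -(1 / 2)) - 1 / 2 * κ
      + (1 / 4) * (0 - -2 * hurwitzLerchQuarterDerivSeries t) = zetaScrewDeriv t := by
    rw [hurwitzLerchQuarterDerivSeries_eq h0, zetaScrewDeriv, hκ]
    ring
  rw [hval] at hF'
  exact hF'.congr_of_eventuallyEq hFeq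

/-- Corollary: `Ψ` is differentiable at every point of `(0, log 2)`. [folklore] -/
theorem differentiableAt_zetaScrew {t : ℝ} (h0 : 0 < t) (h2 : t < Real.log 2) :
    DifferentiableAt ℝ zetaScrew t :=
  (hasDerivAt_zetaScrew h0 h2).differentiableAt

/-- Corollary: `deriv Ψ = zetaScrewDeriv` on `(0, log 2)`. [folklore] -/
theorem deriv_zetaScrew {t : ℝ} (h0 : 0 < t) (h2 : t < Real.log 2) :
    deriv zetaScrew t = zetaScrewDeriv t :=
  (hasDerivAt_zetaScrew h0 h2).deriv


/-! ## The second derivative of `Ψ` on `(0, log 2)` (closed form, elementary) -/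

/-- `Ψ''(t) = e^{t/2} + e^{−t/2} − w/(2(1−w²)) − w/(2(1+w²))`, `w = e^{−t/2}`
(`= 2 cosh(t/2) − e^{−t/2}/(1 − e^{−2t})`). [folklore] -/
def zetaScrewDeriv2 (t : ℝ) : ℝ :=
  Real.exp (t / 2) + Real.exp (-(t / 2))
    - Real.exp (-(t / 2)) / (2 * (1 - Real.exp (-(t / 2)) ^ 2))
    - Real.exp (-(t / 2)) / (2 * (1 + Real.exp (-(t / 2)) ^ 2))

/-- **The derivative of the closed form `Ψ'`** for `t > 0` (elementary: `exp`, `log`, `arctan`). [folklore] -/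
theorem hasDerivAt_zetaScrewDeriv {t : ℝ} (ht : 0 < t) :
    HasDerivAt zetaScrewDeriv (zetaScrewDeriv2 t) t := by
  set w := Real.exp (-(t / 2)) with hw
  have hw0 : 0 < w := Real.exp_pos _
  have hw1 : w < 1 := by rw [hw, Real.exp_lt_one_iff]; linarith
  have hwd : HasDerivAt (fun y : ℝ => Real.exp (-(y / 2))) (w * -(1 / 2)) t := by
    have h := ((hasDerivAt_id t).div_const 2).neg.exp
    simp only [id] at h
    exact h
  have hA : HasDerivAt (fun y : ℝ => Real.exp (y / 2)) (Real.exp (t / 2) * (1 / 2)) t := by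
    have h := ((hasDerivAt_id t).div_const 2).exp
    simp only [id] at h
    exact h
  have h1 : HasDerivAt (fun y : ℝ => Real.log (1 + Real.exp (-(y / 2)))) ((w * -(1 / 2)) / (1 + w)) t := by
    have h := (hwd.const_add 1).log (by rw [← hw]; linarith)
    simpa [hw] using h
  have h2 : HasDerivAt (fun y : ℝ => Real.log (1 - Real.exp (-(y / 2)))) ((-(w * -(1 / 2))) / (1 - w)) t := by
    have h := ((hasDerivAt_const t (1 : ℝ)).sub hwd).log (by
      simp only [Pi.sub_apply]
      exact (sub_pos.2 (by rw [Real.exp_lt_one_iff]; linarith)).ne')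
    simpa [hw] using h
  have h3 := (Real.hasDerivAt_arctan w).comp t hwd
  set κ := Real.eulerMascheroniConstant + Real.pi / 2 + 3 * Real.log 2 + Real.log Real.pi with hκ
  have h := ((((hA.sub hwd).const_mul 2).sub_const (κ / 2)).add (((h1.sub h2).div_const 2).add h3))
  have hfun : zetaScrewDeriv = fun y => 2 * (Real.exp (y / 2) - Real.exp (-(y / 2))) - κ / 2
      + ((Real.log (1 + Real.exp (-(y / 2))) - Real.log (1 - Real.exp (-(y / 2)))) / 2
        + (Real.arctan ∘ fun y : ℝ => Real.exp (-(y / 2))) y) := by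
    funext y; simp [zetaScrewDeriv, hκ, Function.comp_apply]
  rw [hfun]
  refine (h.congr_of_eventuallyEq (Filter.Eventually.of_forall fun y => ?_)).congr_deriv ?_
  · simp only [Pi.add_apply, Pi.sub_apply, Function.comp_apply]
  · unfold zetaScrewDeriv2
    rw [← hw]
    have h1w : (1 : ℝ) + w ≠ 0 := by linarith
    have h2w : (1 : ℝ) - w ≠ 0 := by linarith
    have h3w : (1 : ℝ) - w ^ 2 ≠ 0 := by nlinarith
    have h4w : (1 : ℝ) + w ^ 2 ≠ 0 := by nlinarith
    field_simp
    ring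

/-! ## The third derivative (closed form) -/

/-- `Ψ⁽³⁾` in closed form (`w = e^{−t/2}`). [folklore] -/
def zetaScrewDeriv3 (t : ℝ) : ℝ :=
  Real.exp (t / 2) / 2 - Real.exp (-(t / 2)) / 2
    + Real.exp (-(t / 2)) * (1 + Real.exp (-(t / 2)) ^ 2) / (4 * (1 - Real.exp (-(t / 2)) ^ 2) ^ 2)
    + Real.exp (-(t / 2)) * (1 - Real.exp (-(t / 2)) ^ 2) / (4 * (1 + Real.exp (-(t / 2)) ^ 2) ^ 2)

/-- The derivative of `Ψ''` for `t > 0`. [folklore] -/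
theorem hasDerivAt_zetaScrewDeriv2 {t : ℝ} (ht : 0 < t) :
    HasDerivAt zetaScrewDeriv2 (zetaScrewDeriv3 t) t := by
  set w := Real.exp (-(t / 2)) with hw
  have hw0 : 0 < w := Real.exp_pos _
  have hw1 : w < 1 := by rw [hw, Real.exp_lt_one_iff]; linarith
  have h1w : (1 : ℝ) - w ^ 2 ≠ 0 := by nlinarith
  have h2w : (1 : ℝ) + w ^ 2 ≠ 0 := by nlinarith
  have hwd : HasDerivAt (fun y : ℝ => Real.exp (-(y / 2))) (w * -(1 / 2)) t := by
    have h := ((hasDerivAt_id t).div_const 2).neg.exp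
    simp only [id] at h
    exact h
  have hA : HasDerivAt (fun y : ℝ => Real.exp (y / 2)) (Real.exp (t / 2) * (1 / 2)) t := by
    have h := ((hasDerivAt_id t).div_const 2).exp
    simp only [id] at h
    exact h
  have hden1 : HasDerivAt (fun y : ℝ => 2 * (1 - Real.exp (-(y / 2)) ^ 2))
      (2 * (-(2 * w * (w * -(1 / 2))))) t := by
    have h := ((hwd.pow 2).const_sub 1).const_mul 2
    refine h.congr_deriv ?_
    simp [hw]
  have hden2 : HasDerivAt (fun y : ℝ => 2 * (1 + Real.exp (-(y / 2)) ^ 2))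
      (2 * (2 * w * (w * -(1 / 2)))) t := by
    have h := ((hwd.pow 2).const_add 1).const_mul 2
    refine h.congr_deriv ?_
    simp [hw]
  have hq1 := hwd.div hden1 (by rw [← hw]; exact mul_ne_zero two_ne_zero h1w)
  have hq2 := hwd.div hden2 (by rw [← hw]; exact mul_ne_zero two_ne_zero h2w)
  have h := ((hA.add hwd).sub hq1).sub hq2
  have hfun : zetaScrewDeriv2 = fun y => Real.exp (y / 2) + Real.exp (-(y / 2))
      - Real.exp (-(y / 2)) / (2 * (1 - Real.exp (-(y / 2)) ^ 2))
      - Real.exp (-(y / 2)) / (2 * (1 + Real.exp (-(y / 2)) ^ 2)) := by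
    funext y; simp [zetaScrewDeriv2]
  rw [hfun]
  refine (h.congr_of_eventuallyEq (Filter.Eventually.of_forall fun y => ?_)).congr_deriv ?_
  · simp only [Pi.add_apply, Pi.sub_apply, Pi.div_apply]
  · unfold zetaScrewDeriv3
    rw [← hw]
    field_simp
    ring


end Summit.RiemannHypothesis.RiemannHypothesis.Theorems.IntegerScrew

end
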